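import Summits.ResolutionOfSingularities.ResolutionOfSingularities.Theorems.FrobeniusLadderFInjectiveMacaulayficationPencilChartPackage
import HarnessLib

/-!
# BED Ω, GLOBAL PATCH (g-b), F6 GLUE: the FULL (`FullCl p`) twins of ✓p709719 `PencilBlowupLocalCharts.cmCl_stalk_of_pair` and of the (P)/(Q) packages of ✓p712528 `PencilChartPackage` —
# over a pencil chart, `S′` is FULL at every stalk as soon as every localization of the two pencil rings `A[X]/(uX − v)`, `A[X]/(vX − u)` is; over a principal chart FULL passes from `X̃`
# (crux `FInjectiveMacaulayfication` stmt-ResolutionOfSingularities-15315, chain w45a; `g13/GLOBAL-PATCH-PLAN.md` F6 «every blow-up S″ → S′ along 𝓚 is FullCl at EVERY point … (cone chart × pencil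
# chart)»; seat res-L1-w45a-stub-3 g14)

[OURS · L1 W4.5a] Support file (`--supports stmt-ResolutionOfSingularities-15315 --as helper`); theorems only; GENERIC; no named fact; NOT a statement of any manuscript; nothing of the crux is proved
(the FULL inputs per pencil ring are hypotheses — on the cure fan Σ₂ they are the exit-tag theorems of ✓ `PencilExitTagMaster` after the étale legs of ✓p708620). AI-written (AI review is weaker
than expert review).
* §1 `fullCl_localization_of_ringEquiv'`, `fullCl_stalk_of_affineOpen_ringEquiv`, ★★ `fullCl_stalk_of_pair`.
* §2 ★★ `fullCl_stalk_over_pencilChart` ((P) with FULL hypotheses on the two pencil rings of the chart), ★★ `fullCl_stalk_over_principalChart` ((Q): FULL from `𝒪_{X̃, τ s}`).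
[cite: StacksProject, Tag 0804, Tag 0BIQ, Tag 02OS; Matsumura1987, Thm. 17.4]
-/

set_option linter.dupNamespace false

noncomputable section

open AlgebraicGeometry CategoryTheory Literature.AlgebraicGeometry.Resolution MvPolynomial

namespace Summit.ResolutionOfSingularities.ResolutionOfSingularities.Theorems.FInjectiveMacaulayfication.PencilBlowupLocalChartsFull

open Summit.ResolutionOfSingularities.ResolutionOfSingularities.Theorems.FInjectiveMacaulayfication
open SliceableCentre PencilBlowupLocalCharts

/-! ## §1 FULL over a pencil open -/

/-- `FullCl p` at EVERY localization transports along a ring isomorphism `e : A ≃+* B`. [folklore transport] -/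
theorem fullCl_localization_of_ringEquiv' (p : ℕ) {A B : Type} [CommRing A] [CommRing B] (e : A ≃+* B)
    (h : ∀ (Q : Ideal B) [Q.IsPrime], FullCl p (Localization.AtPrime Q)) (P : Ideal A) [P.IsPrime] : FullCl p (Localization.AtPrime P) := by
  set Q : Ideal B := P.comap e.symm.toRingHom with hQ
  haveI : Q.IsPrime := Ideal.comap_isPrime e.symm.toRingHom P
  have eP : Localization.AtPrime P ≃+* Localization.AtPrime Q := by
    refine IsLocalization.ringEquivOfRingEquiv (M := P.primeCompl) (T := Q.primeCompl) (Localization.AtPrime P) (Localization.AtPrime Q) e ?_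
    ext y
    simp only [Submonoid.mem_map]
    constructor
    · rintro ⟨b, hb, rfl⟩
      intro hy
      exact hb (by simpa [hQ, Ideal.mem_comap] using hy)
    · intro hy
      refine ⟨e.symm y, fun h' => hy ?_, e.apply_symm_apply y⟩
      simpa [hQ, Ideal.mem_comap] using h'
  exact fullCl_of_ringEquiv' p eP.symm (h Q)

/-- `FullCl p` at a point of an affine open from `FullCl p` at every localization of (a ring isomorphic to) its section ring. [folklore transport] -/
theorem fullCl_stalk_of_affineOpen_ringEquiv (p : ℕ) {Y : Scheme.{0}} {V : Y.Opens} (hV : IsAffineOpen V) {B : Type} [CommRing B] (ε : Γ(Y, V) ≃+* B)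
    (hB : ∀ (Q : Ideal B) [Q.IsPrime], FullCl p (Localization.AtPrime Q)) (y : Y) (hy : y ∈ V) : FullCl p (Y.presheaf.stalk y) := by
  letI : Algebra Γ(Y, V) (Y.presheaf.stalk y) := TopCat.Presheaf.algebra_section_stalk Y.presheaf (⟨y, hy⟩ : V)
  haveI : IsLocalization.AtPrime (Y.presheaf.stalk y) (hV.primeIdealOf ⟨y, hy⟩).asIdeal := hV.isLocalization_stalk ⟨y, hy⟩
  exact fullCl_of_ringEquiv' p
    (IsLocalization.algEquiv (hV.primeIdealOf ⟨y, hy⟩).asIdeal.primeCompl (Localization.AtPrime (hV.primeIdealOf ⟨y, hy⟩).asIdeal) (Y.presheaf.stalk y)).toRingEquiv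
    (fullCl_localization_of_ringEquiv' p ε hB _)

section Local

variable {Xt S' : Scheme.{0}} {τ : S' ⟶ Xt} {𝒥 : Xt.IdealSheafData}

/-- ★★ **FULL STALKS OVER A PENCIL OPEN.** In the setting of ✓ `exists_chart_ringEquiv_of_pair` (`𝒥(W) = (γu, γv)`, `γ` regular, `(u, v)`, `(v, u)` regular pairs of `A = Γ(X̃, W)`): if every localization
of `A[X]/(uX − v)` and of `A[X]/(vX − u)` is `FullCl p`, then so is `𝒪_{S′,s}` for every `s` over `W`. [OURS · F6 glue; cite: StacksProject, Tag 0804 and Tag 0BIQ] -/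
theorem fullCl_stalk_of_pair (p : ℕ) (hτ : IsBlowup τ 𝒥) (W : Xt.affineOpens) (γ u v : Γ(Xt, W)) (h𝒥 : 𝒥.ideal W = Ideal.span {γ * u, γ * v})
    (hγ : γ ∈ nonZeroDivisors Γ(Xt, W)) (hu : u ∈ nonZeroDivisors Γ(Xt, W)) (huv : ∀ r : Γ(Xt, W), u ∣ r * v → u ∣ r)
    (hv : v ∈ nonZeroDivisors Γ(Xt, W)) (hvu : ∀ r : Γ(Xt, W), v ∣ r * u → v ∣ r)
    (hW : ∀ (Q : Ideal ((Polynomial Γ(Xt, W)) ⧸ Ideal.span {Polynomial.C u * Polynomial.X - Polynomial.C v})) [Q.IsPrime], FullCl p (Localization.AtPrime Q))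
    (hU : ∀ (Q : Ideal ((Polynomial Γ(Xt, W)) ⧸ Ideal.span {Polynomial.C v * Polynomial.X - Polynomial.C u})) [Q.IsPrime], FullCl p (Localization.AtPrime Q))
    (s : S') (hs : τ.base s ∈ (W : Xt.Opens)) : FullCl p (S'.presheaf.stalk s) := by
  obtain ⟨V, hV, hsV, hiso⟩ := exists_chart_ringEquiv_of_pair hτ W γ u v h𝒥 hγ hu huv hv hvu ⟨s, hs⟩
  have key : FullCl p ((τ ⁻¹ᵁ (W : Xt.Opens)).toScheme.presheaf.stalk (⟨s, hs⟩ : ↥(τ ⁻¹ᵁ (W : Xt.Opens)))) := by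
    rcases hiso with ⟨⟨ε⟩⟩ | ⟨⟨ε⟩⟩
    · exact fullCl_stalk_of_affineOpen_ringEquiv p hV ε hW _ hsV
    · exact fullCl_stalk_of_affineOpen_ringEquiv p hV ε hU _ hsV
  exact fullCl_of_ringEquiv' p ((τ ⁻¹ᵁ (W : Xt.Opens)).stalkIso ⟨s, hs⟩).commRingCatIsoToRingEquiv key

end Local

/-! ## §2 The FULL packages on a toric chart of the class model -/

section Chart

variable {n : ℕ} {k : Type} [Field k]
variable (f : MvPolynomial (Fin n) k) (V : Matrix (Fin n) (Fin n) ℕ) (hV : IsUnit (V.map (Nat.cast : ℕ → ℤ)).det)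
  (m : Fin n →₀ ℕ) (a : Fin n → (Fin n →₀ ℕ))
  (hgen : ∀ i : Fin n, (Finsupp.equivFunOnFinite.symm (V.mulVec ⇑(a i)) : Fin n →₀ ℕ) =
    Finsupp.equivFunOnFinite.symm (V.mulVec ⇑m) + Finsupp.single i 1)
  (A : Finset (Fin n →₀ ℕ)) (haA : ∀ i, a i ∈ A) (hmA : m ∈ A)
  (hge : ∀ e ∈ A, (Finsupp.equivFunOnFinite.symm (V.mulVec ⇑m) : Fin n →₀ ℕ) ≤
    Finsupp.equivFunOnFinite.symm (V.mulVec ⇑e))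
  (d : Fin n →₀ ℕ) (θ : MvPolynomial (Fin n) k)
  (hθ : aeval (fun j : Fin n => ∏ i : Fin n, (X i : MvPolynomial (Fin n) k) ^ V i j) f = monomial d (1 : k) * θ)
  (hprime : (Ideal.span {f}).IsPrime) (hXne : ∀ j : Fin n, Ideal.Quotient.mk (Ideal.span {f}) (X j) ≠ 0)
  (hcop : ∀ i : Fin n, ¬ (X i ∣ θ))
  (hm : Ideal.Quotient.mk (Ideal.span {f}) (monomial m (1 : k)) ∈
    Ideal.span ((fun e : Fin n →₀ ℕ => Ideal.Quotient.mk (Ideal.span {f}) (monomial e (1 : k))) '' (A : Set (Fin n →₀ ℕ))))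
  (g₀ : MvPolynomial (Fin n) k) (G M₁ : Fin n →₀ ℕ) (χ : MvPolynomial (Fin n) k)
  (hg₀ : aeval (fun j : Fin n => ∏ i : Fin n, (X i : MvPolynomial (Fin n) k) ^ V i j) g₀ = monomial G (1 : k) * χ)
  (hC : (Finsupp.equivFunOnFinite.symm (V.mulVec ⇑m) : Fin n →₀ ℕ) = G + M₁)

include hV hgen haA hmA hge hθ hprime hXne hcop hg₀ hC in
set_option maxHeartbeats 800000 in
-- large binder block; the glue lemma is instantiated at the explicit centre
/-- ★★ **(P, FULL) FULL STALKS OVER A PENCIL CHART**: as ✓ `PencilChartPackage.cmCl_stalk_over_pencilChart`, with `FullCl p` of every localization of the two pencil rings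
`Γ[X]/(uX − v)`, `Γ[X]/(vX − u)` (`Γ = Γ(X̃, D₊(x^m t)) ≅ k[y]/(θ)` via `Φ`, `u = Φ⁻¹ȳ^{M₁}`, `v = Φ⁻¹χ̄`) as hypotheses (stated for every section-ring isomorphism `Φ`, so that the exit-tag
theorems can be plugged in through ✓ `PencilQuotFinSucc.exists_ringEquiv_pencilQuot_finSucc`). [OURS · F6 glue; cite: StacksProject, Tag 0804, Tag 0BIQ] -/
theorem fullCl_stalk_over_pencilChart (p : ℕ) (hθp : Prime θ) (hθχ : ¬ θ ∣ χ) (hpair : (Ideal.span {θ, χ}).IsPrime)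
    (hM₁ : (monomial M₁ (1 : k) : MvPolynomial (Fin n) k) ∉ Ideal.span {θ, χ})
    (hFW : ∀ (Φ : Γ(affineBlowup (Ideal.span ((fun e : Fin n →₀ ℕ => Ideal.Quotient.mk (Ideal.span {f}) (monomial e (1 : k))) '' (A : Set (Fin n →₀ ℕ)))),
        affineBlowup.chartOpen (Ideal.Quotient.mk (Ideal.span {f}) (monomial m (1 : k))) hm) ≃+* (MvPolynomial (Fin n) k ⧸ Ideal.span {θ})),
      (∀ q : MvPolynomial (Fin n) k,
        Φ (affineBlowup.pull (Ideal.span ((fun e : Fin n →₀ ℕ => Ideal.Quotient.mk (Ideal.span {f}) (monomial e (1 : k))) '' (A : Set (Fin n →₀ ℕ))))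
            (affineBlowup.chartOpen (Ideal.Quotient.mk (Ideal.span {f}) (monomial m (1 : k))) hm) (Ideal.Quotient.mk (Ideal.span {f}) q)) =
          Ideal.Quotient.mk (Ideal.span {θ}) (aeval (fun j : Fin n => ∏ i : Fin n, (X i : MvPolynomial (Fin n) k) ^ V i j) q)) →
      (∀ (Q : Ideal (Polynomial Γ(affineBlowup (Ideal.span ((fun e : Fin n →₀ ℕ => Ideal.Quotient.mk (Ideal.span {f}) (monomial e (1 : k))) '' (A : Set (Fin n →₀ ℕ)))),
          affineBlowup.chartOpen (Ideal.Quotient.mk (Ideal.span {f}) (monomial m (1 : k))) hm) ⧸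
          Ideal.span {Polynomial.C (Φ.symm (Ideal.Quotient.mk (Ideal.span {θ}) (monomial M₁ 1))) * Polynomial.X - Polynomial.C (Φ.symm (Ideal.Quotient.mk (Ideal.span {θ}) χ))})) [Q.IsPrime],
        FullCl p (Localization.AtPrime Q)) ∧
      (∀ (Q : Ideal (Polynomial Γ(affineBlowup (Ideal.span ((fun e : Fin n →₀ ℕ => Ideal.Quotient.mk (Ideal.span {f}) (monomial e (1 : k))) '' (A : Set (Fin n →₀ ℕ)))),
          affineBlowup.chartOpen (Ideal.Quotient.mk (Ideal.span {f}) (monomial m (1 : k))) hm) ⧸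
          Ideal.span {Polynomial.C (Φ.symm (Ideal.Quotient.mk (Ideal.span {θ}) χ)) * Polynomial.X - Polynomial.C (Φ.symm (Ideal.Quotient.mk (Ideal.span {θ}) (monomial M₁ 1)))})) [Q.IsPrime],
        FullCl p (Localization.AtPrime Q)))
    {S' : Scheme.{0}} {τ : S' ⟶ affineBlowup (Ideal.span ((fun e : Fin n →₀ ℕ => Ideal.Quotient.mk (Ideal.span {f}) (monomial e (1 : k))) '' (A : Set (Fin n →₀ ℕ))))}
    (hτ : IsBlowup τ ((affineBlowup.idealSheaf (Ideal.span ((fun e : Fin n →₀ ℕ => Ideal.Quotient.mk (Ideal.span {f}) (monomial e (1 : k))) '' (A : Set (Fin n →₀ ℕ))) +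
        Ideal.span {Ideal.Quotient.mk (Ideal.span {f}) g₀})).comap
        (affineBlowup.π (Ideal.span ((fun e : Fin n →₀ ℕ => Ideal.Quotient.mk (Ideal.span {f}) (monomial e (1 : k))) '' (A : Set (Fin n →₀ ℕ)))))))
    (s : S') (hs : τ.base s ∈ (affineBlowup.chartOpen (Ideal.Quotient.mk (Ideal.span {f}) (monomial m (1 : k))) hm :
      (affineBlowup (Ideal.span ((fun e : Fin n →₀ ℕ => Ideal.Quotient.mk (Ideal.span {f}) (monomial e (1 : k))) '' (A : Set (Fin n →₀ ℕ))))).Opens)) :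
    FullCl p (S'.presheaf.stalk s) := by
  obtain ⟨Φ, hΦ⟩ := PencilChartPackage.exists_sections_ringEquiv_of_isPrime f V hV m a hgen A haA hge d θ hθ hprime hXne hcop hm
  have h𝒥 := PencilChartPackage.ideal_chart_eq f V m A hmA hge θ hm g₀ G M₁ χ hg₀ hC Φ hΦ
  obtain ⟨hW, hU⟩ := hFW Φ hΦ
  haveI : (Ideal.span {θ}).IsPrime := (Ideal.span_singleton_prime hθp.ne_zero).mpr hθp
  haveI : IsDomain (MvPolynomial (Fin n) k ⧸ Ideal.span {θ}) := Ideal.Quotient.isDomain _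
  have hGnzd := PencilQuotFinSucc.mk_mem_nonZeroDivisors hθp (PencilQuotFinSucc.not_dvd_monomial_of_forall_not_X_dvd hθp hcop G)
  have hM₁ndvd := PencilQuotFinSucc.not_dvd_monomial_of_forall_not_X_dvd hθp hcop M₁
  have hUnzd := PencilQuotFinSucc.mk_mem_nonZeroDivisors hθp hM₁ndvd
  have hVnzd := PencilQuotFinSucc.mk_mem_nonZeroDivisors hθp hθχ
  have hVU : ∀ r : MvPolynomial (Fin n) k ⧸ Ideal.span {θ}, Ideal.Quotient.mk (Ideal.span {θ}) χ ∣ r * Ideal.Quotient.mk (Ideal.span {θ}) (monomial M₁ 1) →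
      Ideal.Quotient.mk (Ideal.span {θ}) χ ∣ r := PencilQuotFinSucc.regularPair_of_isPrime hpair hM₁
  have hUV : ∀ r : MvPolynomial (Fin n) k ⧸ Ideal.span {θ}, Ideal.Quotient.mk (Ideal.span {θ}) (monomial M₁ 1) ∣ r * Ideal.Quotient.mk (Ideal.span {θ}) χ →
      Ideal.Quotient.mk (Ideal.span {θ}) (monomial M₁ 1) ∣ r := PencilQuotFinSucc.regularPair_symm (nonZeroDivisors.ne_zero hVnzd) hVU
  obtain ⟨hu, huv⟩ := regularPair_of_ringEquiv Φ.symm hUnzd hUV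
  obtain ⟨hv, hvu⟩ := regularPair_of_ringEquiv Φ.symm hVnzd hVU
  have hγ : Φ.symm (Ideal.Quotient.mk (Ideal.span {θ}) (monomial G 1)) ∈ nonZeroDivisors _ :=
    (regularPair_of_ringEquiv Φ.symm hGnzd (v := 1) (fun r h => by simpa using h)).1
  exact fullCl_stalk_of_pair p hτ _ _ _ _ h𝒥 hγ hu huv hv hvu hW hU s hs

include hV hgen haA hmA hge hθ hprime hXne hcop hg₀ hC in
set_option maxHeartbeats 800000 in
-- large binder block; the glue lemma is instantiated at the explicit centre
/-- ★★ **(Q, FULL) FULL STALKS OVER A PRINCIPAL CHART**: as ✓ `PencilChartPackage.cmCl_stalk_over_principalChart`, with `FullCl p` in place of the CM clause (✓ `fullCl_stalk_of_principal`).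
[OURS · F6 glue; cite: StacksProject, Tag 02OS] -/
theorem fullCl_stalk_over_principalChart (p : ℕ) (hGθ : ¬ θ ∣ monomial G (1 : k)) (hunitM : IsUnit (Ideal.Quotient.mk (Ideal.span {θ}) (monomial M₁ (1 : k))))
    {S' : Scheme.{0}} {τ : S' ⟶ affineBlowup (Ideal.span ((fun e : Fin n →₀ ℕ => Ideal.Quotient.mk (Ideal.span {f}) (monomial e (1 : k))) '' (A : Set (Fin n →₀ ℕ))))}
    (hτ : IsBlowup τ ((affineBlowup.idealSheaf (Ideal.span ((fun e : Fin n →₀ ℕ => Ideal.Quotient.mk (Ideal.span {f}) (monomial e (1 : k))) '' (A : Set (Fin n →₀ ℕ))) +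
        Ideal.span {Ideal.Quotient.mk (Ideal.span {f}) g₀})).comap
        (affineBlowup.π (Ideal.span ((fun e : Fin n →₀ ℕ => Ideal.Quotient.mk (Ideal.span {f}) (monomial e (1 : k))) '' (A : Set (Fin n →₀ ℕ)))))))
    (s : S') (hs : τ.base s ∈ (affineBlowup.chartOpen (Ideal.Quotient.mk (Ideal.span {f}) (monomial m (1 : k))) hm :
      (affineBlowup (Ideal.span ((fun e : Fin n →₀ ℕ => Ideal.Quotient.mk (Ideal.span {f}) (monomial e (1 : k))) '' (A : Set (Fin n →₀ ℕ))))).Opens))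
    (hX : FullCl p ((affineBlowup (Ideal.span ((fun e : Fin n →₀ ℕ => Ideal.Quotient.mk (Ideal.span {f}) (monomial e (1 : k))) '' (A : Set (Fin n →₀ ℕ))))).presheaf.stalk (τ.base s))) :
    FullCl p (S'.presheaf.stalk s) := by
  obtain ⟨Φ, hΦ⟩ := PencilChartPackage.exists_sections_ringEquiv_of_isPrime f V hV m a hgen A haA hge d θ hθ hprime hXne hcop hm
  have h𝒥 := PencilChartPackage.ideal_chart_eq f V m A hmA hge θ hm g₀ G M₁ χ hg₀ hC Φ hΦ
  haveI := hprime
  haveI : IsDomain (MvPolynomial (Fin n) k ⧸ Ideal.span {f}) := Ideal.Quotient.isDomain _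
  have hm0 : Ideal.Quotient.mk (Ideal.span {f}) (monomial m (1 : k)) ≠ 0 := by
    classical
    rw [monomial_eq, MvPolynomial.C_1, one_mul, Finsupp.prod, map_prod]
    exact Finset.prod_ne_zero_iff.mpr fun j _ => by rw [map_pow]; exact pow_ne_zero _ (hXne j)
  haveI : IsIntegral (affineBlowup (Ideal.span ((fun e : Fin n →₀ ℕ => Ideal.Quotient.mk (Ideal.span {f}) (monomial e (1 : k))) '' (A : Set (Fin n →₀ ℕ))))) :=
    affineBlowup.isIntegral fun h0 => hm0 (by rw [← Ideal.mem_bot, ← h0]; exact hm)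
  haveI : IsDomain Γ(affineBlowup (Ideal.span ((fun e : Fin n →₀ ℕ => Ideal.Quotient.mk (Ideal.span {f}) (monomial e (1 : k))) '' (A : Set (Fin n →₀ ℕ)))),
      (affineBlowup.chartOpen (Ideal.Quotient.mk (Ideal.span {f}) (monomial m (1 : k))) hm :
        (affineBlowup (Ideal.span ((fun e : Fin n →₀ ℕ => Ideal.Quotient.mk (Ideal.span {f}) (monomial e (1 : k))) '' (A : Set (Fin n →₀ ℕ))))).Opens)) :=
    @IsIntegral.component_integral _ inferInstance _ ⟨⟨τ.base s, hs⟩⟩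
  have hγ0 : Φ.symm (Ideal.Quotient.mk (Ideal.span {θ}) (monomial G 1)) ≠ 0 := by
    intro h0
    have h1 : Ideal.Quotient.mk (Ideal.span {θ}) (monomial G (1 : k)) = 0 := by rw [← Φ.apply_symm_apply (Ideal.Quotient.mk _ _), h0, map_zero]
    rw [Ideal.Quotient.eq_zero_iff_mem, Ideal.mem_span_singleton] at h1
    exact hGθ h1
  have hγ : Φ.symm (Ideal.Quotient.mk (Ideal.span {θ}) (monomial G 1)) ∈ nonZeroDivisors _ := mem_nonZeroDivisors_of_ne_zero hγ0
  have hunit' : IsUnit (Φ.symm (Ideal.Quotient.mk (Ideal.span {θ}) (monomial M₁ (1 : k)))) := hunitM.map Φ.symm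
  have h𝒥' : ((affineBlowup.idealSheaf (Ideal.span ((fun e : Fin n →₀ ℕ => Ideal.Quotient.mk (Ideal.span {f}) (monomial e (1 : k))) '' (A : Set (Fin n →₀ ℕ))) +
        Ideal.span {Ideal.Quotient.mk (Ideal.span {f}) g₀})).comap
        (affineBlowup.π (Ideal.span ((fun e : Fin n →₀ ℕ => Ideal.Quotient.mk (Ideal.span {f}) (monomial e (1 : k))) '' (A : Set (Fin n →₀ ℕ)))))).ideal
        (affineBlowup.chartOpen (Ideal.Quotient.mk (Ideal.span {f}) (monomial m (1 : k))) hm) =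
      Ideal.span {Φ.symm (Ideal.Quotient.mk (Ideal.span {θ}) (monomial G 1))} := by
    rw [h𝒥, Ideal.span_insert, Ideal.span_singleton_mul_right_unit hunit', sup_eq_left]
    exact Ideal.span_singleton_le_span_singleton.mpr (dvd_mul_right _ _)
  exact fullCl_stalk_of_principal p hτ _ _ h𝒥' hγ s hs hX

end Chart

end Summit.ResolutionOfSingularities.ResolutionOfSingularities.Theorems.FInjectiveMacaulayfication.PencilBlowupLocalChartsFull

end
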